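import Literature.MathematicalPhysics.QuantumLattice.PairFieldMomentum

/-!
# Stub `stub_fullWindow` of line `Sketch` (idea `parabolic-descent`)
# (crux `WindowGap`, item stmt-HubbardSuperconductivity-1088, route KacWindowPenalty)

At a FULL momentum window the Kac-window pair penalty of the crux `WindowGap` is the LOCAL `d`-wave
pair repulsion. On the fermionic torus `(ℤ/Lℤ)²` the window condition of a momentum label
`m ∈ (ℤ/Lℤ)²` reads `|q_m|² = (2π/L)² Σᵢ (valMinAbs mᵢ)² ≤ ε²`; since the representative of least
absolute value satisfies `2 |valMinAbs mᵢ| ≤ L` (Mathlib's `ZMod.valMinAbs_mem_Ioc`), every label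
has `|q_m|² ≤ (2π/L)² · 2 · (L/2)² = 2π²`, so for `ε² ≥ 2π²` EVERY label passes the window test
(`momentum_window_of_full`). The penalty is then the full Fourier sum
`L⁻² Σ_m Δ_d(m)ᴴ Δ_d(m)`, `Δ_d(m) = pairFieldAt dWaveFormFactor L m`, which the operator Parseval
identity `sum_conjTranspose_pairFieldAt_mul_self` (`Σ_m Δ_d(m)ᴴ Δ_d(m) = L² Σ_x P_xᴴ P_x`, the
Kennedy–Lieb–Shastry sum rule) turns into `Σ_x P_xᴴ P_x`, `P_x = localPair dWaveFormFactor L x`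
(`stub_fullWindow`, the registered signature verbatim).

Source: T. Kennedy, E. H. Lieb, B. S. Shastry, PRL **61** (1988) 2582, p. 2582 (Parseval sum rule
for the Fourier modes of an order operator) [KLS1988PRL]. Finite Fourier analysis only; no physics,
no new definitions. Supports the crux (`--supports stmt-HubbardSuperconductivity-1088`).
-/

-- the mandated namespace repeats HubbardSuperconductivity (single-problem summit, D-0017)
set_option linter.dupNamespace false

noncomputable section

namespace Summit.HubbardSuperconductivity.HubbardSuperconductivity.Theorems

open Matrix Literature.MathematicalPhysics.QuantumLattice

/-- The centred representative of a residue class mod `L ≠ 0` satisfies `4 (valMinAbs z)² ≤ L²`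
(i.e. `|valMinAbs z| ≤ L/2`; Mathlib's `ZMod.valMinAbs_mem_Ioc : 2·valMinAbs z ∈ (-L, L]`), cast
to `ℝ`. [folklore] -/
theorem four_mul_valMinAbs_sq_le (L : ℕ) [NeZero L] (z : ZMod L) :
    4 * ((z.valMinAbs : ℤ) : ℝ) ^ 2 ≤ (L : ℝ) ^ 2 := by
  have h := z.valMinAbs_mem_Ioc
  have h1 : ((-(L : ℤ) : ℤ) : ℝ) < ((z.valMinAbs * 2 : ℤ) : ℝ) := by exact_mod_cast h.1
  have h2 : ((z.valMinAbs * 2 : ℤ) : ℝ) ≤ ((L : ℤ) : ℝ) := by exact_mod_cast h.2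
  push_cast at h1 h2
  nlinarith [h1, h2]

/-- **Every momentum label lies in a full window.** For `ε² ≥ 2π²` and every `m ∈ (ℤ/Lℤ)²`,
`|q_m|² = (2π/L)² Σᵢ (valMinAbs mᵢ)² ≤ ε²` (each `(valMinAbs mᵢ)² ≤ L²/4`, two coordinates).
[folklore] -/
theorem momentum_window_of_full (L : ℕ) [NeZero L] (ε : ℝ) (hε : 2 * Real.pi ^ 2 ≤ ε ^ 2)
    (m : Fin 2 → ZMod L) :
    (2 * Real.pi / (L : ℝ)) ^ 2 * (∑ i : Fin 2, (((m i).valMinAbs : ℤ) : ℝ) ^ 2) ≤ ε ^ 2 := by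
  have hL : (L : ℝ) ≠ 0 := Nat.cast_ne_zero.2 (NeZero.ne L)
  have hS : ∑ i : Fin 2, (((m i).valMinAbs : ℤ) : ℝ) ^ 2 ≤ (L : ℝ) ^ 2 / 2 := by
    rw [Fin.sum_univ_two]
    linarith [four_mul_valMinAbs_sq_le L (m 0), four_mul_valMinAbs_sq_le L (m 1)]
  calc (2 * Real.pi / (L : ℝ)) ^ 2 * (∑ i : Fin 2, (((m i).valMinAbs : ℤ) : ℝ) ^ 2)
      ≤ (2 * Real.pi / (L : ℝ)) ^ 2 * ((L : ℝ) ^ 2 / 2) :=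
        mul_le_mul_of_nonneg_left hS (sq_nonneg _)
    _ = 2 * Real.pi ^ 2 := by field_simp
    _ ≤ ε ^ 2 := hε

/-- **Stub `stub_fullWindow`: at a full window the Kac-window penalty is the local pair repulsion.**
For `ε² ≥ 2π²` every momentum label passes the window test (`momentum_window_of_full`), whence
`W_ε = L⁻² Σ_m Δ_d(m)ᴴ Δ_d(m) = Σ_x P_xᴴ P_x` by the operator Parseval identity
`sum_conjTranspose_pairFieldAt_mul_self` (`Δ_d(m) = pairFieldAt dWaveFormFactor L m`,
`P_x = localPair dWaveFormFactor L x`). Kennedy–Lieb–Shastry, PRL 61 (1988) 2582 (sum rule).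
[cite: KLS1988PRL, p. 2582] -/
theorem stub_fullWindow (L : ℕ) [NeZero L] (ε : ℝ) (hε : 2 * Real.pi ^ 2 ≤ ε ^ 2) :
    (∑ m : Fin 2 → ZMod L,
      if (2 * Real.pi / (L : ℝ)) ^ 2 * (∑ i : Fin 2, (((m i).valMinAbs : ℤ) : ℝ) ^ 2) ≤ ε ^ 2 then
        ((L : ℂ) ^ 2)⁻¹ • (Matrix.conjTranspose (pairFieldAt dWaveFormFactor L m) *
          pairFieldAt dWaveFormFactor L m)
      else 0) =
      ∑ x : Fin 2 → ZMod L, (localPair dWaveFormFactor L x)ᴴ * localPair dWaveFormFactor L x := by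
  have hL2 : ((L : ℂ) ^ 2) ≠ 0 := pow_ne_zero _ (Nat.cast_ne_zero.2 (NeZero.ne L))
  calc (∑ m : Fin 2 → ZMod L,
        if (2 * Real.pi / (L : ℝ)) ^ 2 * (∑ i : Fin 2, (((m i).valMinAbs : ℤ) : ℝ) ^ 2) ≤ ε ^ 2 then
          ((L : ℂ) ^ 2)⁻¹ • (Matrix.conjTranspose (pairFieldAt dWaveFormFactor L m) *
            pairFieldAt dWaveFormFactor L m)
        else 0)
      = ∑ m : Fin 2 → ZMod L,
          ((L : ℂ) ^ 2)⁻¹ • ((pairFieldAt dWaveFormFactor L m)ᴴ * pairFieldAt dWaveFormFactor L m) :=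
        Finset.sum_congr rfl fun m _ => if_pos (momentum_window_of_full L ε hε m)
    _ = ∑ x : Fin 2 → ZMod L, (localPair dWaveFormFactor L x)ᴴ * localPair dWaveFormFactor L x := by
        rw [← Finset.smul_sum, sum_conjTranspose_pairFieldAt_mul_self, smul_smul,
          inv_mul_cancel₀ hL2, one_smul]

end Summit.HubbardSuperconductivity.HubbardSuperconductivity.Theorems
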